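import Literature.Analysis.FluidPDE.PineauVicolPressureDerivativesDecay
import Literature.Analysis.FluidPDE.PineauVicolSliceDerivativeBounds
import Literature.Analysis.FluidPDE.PineauVicolRDSSLargeAlpha
import HarnessLib

/-!
# Pineau–Vicol 2026, Lemma 8.1 (8.2): `|∂ₛU| ≤ C_s S (1+|α|)²/(1+|y|)` and
# `|∇∂ₛU| ≤ C_s′ S (1+|α|)²/(1+|y|)²` for a jointly smooth `S`-periodic family solving the rotated
# profile equation with `P = RᵢRⱼ(UᵢUⱼ)`

Analysis/FluidPDE proofs file (theorems only; **no definitions, no named facts**), the assembly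
step of the (8.2) programme of the tree's Pineau–Vicol §8 files. B. Pineau, V. Vicol, *On rotated
backwards self-similar solutions of the incompressible 3D Navier–Stokes equations*,
arXiv:2607.09619v2 (2026), §8, Lemma 8.1, pp. 27–28.

## The source, as printed (p. 28)

"Moreover, there exists an `(α, S)`-independent constant `C_{U,s} = C_{U,s}(C_{U,0}) > 0` such that
`|∂ₛU(y, s)| ≤ C_{U,s}S(1 + |α|)²/(1 + |y|)`, `|∇∂ₛU(y, s)| ≤ C_{U,s}S(1 + |α|)²/(1 + |y|²)` (8.2)
for all `(y, s) ∈ ℝ³ × [0, S]`." *Proof of Lemma 8.1.* "By the same argument, one can deduce the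
bounds `|∇ᵏ_yU(y, s)| ≤ C_{U,k}(1 + |y|)^{−k−1}`, `|∇ᵏ_yP(y, s)| ≤ C_{P,k}(1 + |y|)^{−2+σ−k}`,
`k ≥ 0`, (8.3) for all `(y, s)`, uniformly in `α`. Using these bounds, we deduce from the equation
(1.14a) the bound `|∂ₛ∇ᵏU(y, s)| ≤ C_{U,s}(1 + |α|)(1 + |y|)^{−k−1}`, `k ∈ {0,1,2,3}`. Arguing as
in Lemma 2.1, these bounds then imply `|∇ᵏ∂ₛP(y, s)| ≤ C_{U,s}(1 + |α|)(1 + |y|)^{−2+σ−k}`,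
`k ∈ {0,1,2}`. … However, by applying `∂ₛ` to (1.14a) and using the above bounds, along with
(8.3), we obtain `|∂²ₛU(y, s)| ≤ C_{U,s}(1 + |α|)²/(1 + |y|)` … Recalling that `U` is
`[0, S]`-periodic in time, Poincaré's inequality in `s` then gives the bound (8.2)."

## Rendering

Everything is about an ABSTRACT family `U : ℝ → ℝ³ → ℝ³`, jointly `C^∞`
(`IsSmoothSpaceTimeOn univ U`), `S`-periodic in `s`, with slice derivative
`V = ∂ₛU = fun σ y ↦ deriv (U · y) σ`, obeying (8.3) for `U` with ONE constant `C` for the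
orders `j ≤ 6` uniformly in `s` (`(1+|y|)^{j+1}‖DʲU(s,·)(y)‖ ≤ C`, `σ = 0`), and solving on
every slice the rotated profile equation (1.14a) with the Calderón–Zygmund pressure
`P(s) = Q[U(s)]` (`pressurePotential`):
`α𝓡U + ½U + ½DU[y] − ΔU + (U·∇)U + ∇Q[U(s)] + ∂ₛU = 0`. The theorem
`exists_norm_sliceDeriv_le_of_periodic` is the first half of (8.2) with `C_s = C_s(C)` given
before the family (as printed: "`(α, S)`-independent"); `exists_norm_fderiv_sliceDeriv_le_of_periodic`
is the second half (with `(1+|y|)²` in the denominator, which is stronger than the printed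
`1+|y|²`), under (8.3) for `U` at the orders `j ≤ 7`. The proof is the printed one, assembled
from the tree: the first display at `k ≤ 3` (`norm_iteratedFDeriv_sliceDeriv_le_of_slice_equation`,
with (8.3) for `P` from `exists_bound_norm_iteratedFDeriv_pressurePotential_decay`), the second
display at `k = 1` for `∂ₛP = 2Qˢ[∂ₛU, U]` (`exists_bound_norm_fderiv_pressurePotentialSym_decay`),
`∂ₛ` applied to (1.14a) (`dslice_equation_of_isSmoothSpaceTimeOn`), the third display at `k = 0`
(`norm_sliceDeriv2_le_of_dslice_equation`, and its `k = 1` twin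
`norm_fderiv_sliceDeriv2_le_of_dslice_equation` with `|D(ΔV)| ≤ 3|D³V|` and `|D∇P′| ≤ |D²P′|`) and
Poincaré in `s` (`norm_deriv_le_of_periodic`, for the curves `s ↦ U(s,·)(y)` in `ℝ³` and
`s ↦ DU(s,·)(y)` in `ℝ³ →L ℝ³`). The `Swap` section restates both halves for a profile written
`U : ℝ³ → ℝ → ℝ³` (space first, `∂ₛU(y,s) = fderiv ℝ (U y ·) s 1`), the argument order of the
summit-side co-rotating profile lemmas. Finally
`IsTypeIAncientMild.exists_forall_le_pow_mul_norm_iteratedFDeriv_lerayOrbit_of_hasTypeIDecay (N C)`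
packages the class's (8.3) (`TypeIAncientMildDecay`) with ONE constant for all orders `j ≤ N` — the
shape of the (8.3) hypothesis above (`N = 6`, `7`).

Deliberately NOT here: the
instantiation on rotated discretely self-similar solutions (the co-rotating profile of an RDSS
solution and its `S`-periodicity live on the summit side); any statement about Navier–Stokes
regularity. DEVIATION from the print: `C_s`, `C_s′` depend on the common (8.3) constant `C` for the
orders `j ≤ 6` resp. `j ≤ 7`, where the print has `C_{U,s}(C_{U,0})` through the quantitative
Lemma 2.1.

## References

* B. Pineau, V. Vicol, arXiv:2607.09619v2 (2026): §8, Lemma 8.1 (8.2)–(8.3) and its proof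
  (pp. 27–28); (1.14a) (p. 7); Lemma 2.1 (pp. 9–10). [PineauVicol2026]
-/

noncomputable section

open MeasureTheory Set Filter Metric Topology InnerProductSpace Function
open scoped RealInnerProductSpace Laplacian ContDiff ENNReal

namespace Literature.Analysis.FluidPDE

namespace PineauVicol2026

section EightTwo

/-- Elementary weight comparison `1 + a^2 ≤ (1 + a)^2` for `a ≥ 0`. [folklore] -/
private theorem one_add_sq_le_sq_one_add {a : ℝ} (ha : 0 ≤ a) : 1 + a ^ 2 ≤ (1 + a) ^ 2 := by
  nlinarith

/-- Elementary weight comparison `1 + a^3 ≤ (1 + a)^3` for `a ≥ 0`. [folklore] -/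
private theorem one_add_cube_le_cube_one_add {a : ℝ} (ha : 0 ≤ a) : 1 + a ^ 3 ≤ (1 + a) ^ 3 := by
  nlinarith [sq_nonneg a, mul_nonneg ha (sq_nonneg a)]

/-- `c/(1+a)^m ≤ c` for `c, a ≥ 0`. [folklore] -/
private theorem div_one_add_pow_le_self {c a : ℝ} (hc : 0 ≤ c) (ha : 0 ≤ a) (m : ℕ) :
    c / (1 + a) ^ m ≤ c :=
  div_le_self hc (one_le_pow₀ (by linarith))

/-- Weighted form to quotient form. [folklore] -/
private theorem le_div_of_weighted {t w c : ℝ} (hw : 0 < w) (h : w * t ≤ c) : t ≤ c / w := by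
  rw [le_div_iff₀ hw, mul_comm]; exact h

/-- Quotient form to weighted form. [folklore] -/
private theorem weighted_of_le_div {t w c : ℝ} (hw : 0 < w) (h : t ≤ c / w) : w * t ≤ c := by
  rw [le_div_iff₀ hw, mul_comm] at h; exact h

/-- **Pineau–Vicol 2026, Lemma 8.1 (8.2), first half — for an abstract jointly smooth `S`-periodic
family solving (1.14a) with `P = RᵢRⱼ(UᵢUⱼ)` on every slice.** There is `C_s = C_s(C)` such that: if
`U : ℝ → ℝ³ → ℝ³` is jointly `C^∞`, `S`-periodic in `s` (`S > 0`), obeys (8.3) uniformly in `s` up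
to order `6` with constant `C` (`(1+|y|)^{j+1}|DʲU(s,·)(y)| ≤ C`, `j ≤ 6`), and every slice solves
`α𝓡U + ½U + ½DU[y] − ΔU + (U·∇)U + ∇Q[U(s)] + ∂ₛU = 0`, then
`|∂ₛU(y,s)| ≤ C_s S (1+|α|)²/(1+|y|)` for all `(y,s)`. Assembly of the printed proof: the first display
(`norm_iteratedFDeriv_sliceDeriv_le_of_slice_equation`, `k ≤ 3`, with (8.3) for `P` from
`exists_bound_norm_iteratedFDeriv_pressurePotential_decay`), the second display at `k = 1`
(`exists_bound_norm_fderiv_pressurePotentialSym_decay`, `∂ₛP = 2Qˢ[∂ₛU,U]`), `∂ₛ` applied to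
(1.14a) (`dslice_equation_of_isSmoothSpaceTimeOn`) and the third display
(`norm_sliceDeriv2_le_of_dslice_equation`), closed by Poincaré in `s`
(`norm_deriv_le_of_periodic`). DEVIATION: `C_s` depends on the common (8.3) constant `C` for the
orders `j ≤ 6` (the print: on `C_{U,0}` through Lemma 2.1).
[cite: PineauVicol2026, Lemma 8.1 (8.2) and its proof (p. 28)] -/
theorem exists_norm_sliceDeriv_le_of_periodic (C : ℝ) :
    ∃ Cs : ℝ, ∀ (U V : ℝ → EuclideanSpace ℝ (Fin 3) → EuclideanSpace ℝ (Fin 3)) (α S : ℝ), 0 < S → IsSmoothSpaceTimeOn Set.univ U →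
      (V = fun σ y => deriv (fun τ => U τ y) σ) → (∀ σ y, U (σ + S) y = U σ y) →
      (∀ σ, ∀ j ≤ 6, ∀ y, (1 + ‖y‖) ^ (j + 1) * ‖iteratedFDeriv ℝ j (U σ) y‖ ≤ C) →
      (∀ σ y, α • (rotGen (U σ y) - fderiv ℝ (U σ) y (rotGen y)) + (1 / 2 : ℝ) • U σ y +
        (1 / 2 : ℝ) • fderiv ℝ (U σ) y y - (Δ (U σ)) y + convect (U σ) (U σ) y +
          gradient (pressurePotential (U σ)) y + V σ y = 0) →
      ∀ σ y, ‖V σ y‖ ≤ Cs * S * (1 + |α|) ^ 2 / (1 + ‖y‖) := by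
  obtain ⟨A₁, hA₁0, hA₁⟩ := exists_bound_norm_iteratedFDeriv_pressurePotential_decay 1
  obtain ⟨A₂, hA₂0, hA₂⟩ := exists_bound_norm_iteratedFDeriv_pressurePotential_decay 2
  obtain ⟨A₃, hA₃0, hA₃⟩ := exists_bound_norm_iteratedFDeriv_pressurePotential_decay 3
  obtain ⟨A₄, hA₄0, hA₄⟩ := exists_bound_norm_iteratedFDeriv_pressurePotential_decay 4
  obtain ⟨B₁, hB₁0, hB₁⟩ := exists_bound_norm_fderiv_pressurePotentialSym_decay
  -- the constants of the first display at orders 0..3 (without the factor `1+|α|`)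
  obtain ⟨e₀, he₀⟩ : ∃ e : ℝ, e = (2 ^ 0 + 4) * C + 2 ^ 0 * C ^ 2 + A₁ * C ^ 2 := ⟨_, rfl⟩
  obtain ⟨e₁, he₁⟩ : ∃ e : ℝ, e = (2 ^ 1 + 4) * C + 2 ^ 1 * C ^ 2 + A₂ * C ^ 2 := ⟨_, rfl⟩
  obtain ⟨e₂, he₂⟩ : ∃ e : ℝ, e = (2 ^ 2 + 4) * C + 2 ^ 2 * C ^ 2 + A₃ * C ^ 2 := ⟨_, rfl⟩
  obtain ⟨e₃, he₃⟩ : ∃ e : ℝ, e = (2 ^ 3 + 4) * C + 2 ^ 3 * C ^ 2 + A₄ * C ^ 2 := ⟨_, rfl⟩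
  refine ⟨(e₀ + 2 * e₁ + 6 * e₂ + C * e₀ + C * e₁ + 2 * B₁ * (e₀ + e₁ + e₂ + e₃) * C) / 2, ?_⟩
  intro U V α S hS hU hV hper h83 heq
  have ha : 0 ≤ |α| := abs_nonneg α
  have ha1 : 0 ≤ 1 + |α| := by positivity
  -- `C ≥ 0` and the nonnegativity of the constants
  have hC0 : 0 ≤ C := by
    have h := h83 0 0 (by norm_num) 0
    rw [pow_one] at h
    exact le_trans (by positivity) h
  have he₀0 : 0 ≤ e₀ := by rw [he₀]; positivity
  have he₁0 : 0 ≤ e₁ := by rw [he₁]; positivity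
  have he₂0 : 0 ≤ e₂ := by rw [he₂]; positivity
  have he₃0 : 0 ≤ e₃ := by rw [he₃]; positivity
  -- smoothness of the families and slices
  have hUs : ∀ σ, ContDiff ℝ ∞ (U σ) := fun σ => hU.contDiff_slice (Set.mem_univ σ)
  have hU' : IsSmoothSpaceTimeOn Set.univ V := by
    rw [hV]; exact hU.isSmoothSpaceTimeOn_deriv isOpen_univ
  have hVs : ∀ σ, ContDiff ℝ ∞ (V σ) := fun σ => hU'.contDiff_slice (Set.mem_univ σ)
  obtain ⟨W, hW⟩ : ∃ W : ℝ → EuclideanSpace ℝ (Fin 3) → EuclideanSpace ℝ (Fin 3), W = fun σ y => deriv (fun τ => V τ y) σ := ⟨_, rfl⟩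
  have h0 : ∀ τ y, HasDerivAt (fun τ' => U τ' y) (V τ y) τ := by
    intro τ y
    have h := hU.hasDerivAt_timeLine isOpen_univ (Set.mem_univ τ) y
    rw [hV]; exact h
  have h0' : ∀ τ y, HasDerivAt (fun τ' => V τ' y) (W τ y) τ := by
    intro τ y
    have h := hU'.hasDerivAt_timeLine isOpen_univ (Set.mem_univ τ) y
    rw [hW]; exact h
  -- (8.3) for `U`, orders 0, 1, 2, in `fderiv` form
  have hU0 : ∀ σ y, ‖U σ y‖ ≤ C / (1 + ‖y‖) := by
    intro σ y
    have h := h83 σ 0 (by norm_num) y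
    rw [norm_iteratedFDeriv_zero, zero_add, pow_one] at h
    exact le_div_of_weighted (by positivity) h
  have hU1 : ∀ σ y, ‖fderiv ℝ (U σ) y‖ ≤ C / (1 + ‖y‖) ^ 2 := by
    intro σ y
    have h := h83 σ 1 (by norm_num) y
    have e : ‖iteratedFDeriv ℝ 1 (U σ) y‖ = ‖fderiv ℝ (U σ) y‖ := by
      rw [← norm_iteratedFDeriv_fderiv, norm_iteratedFDeriv_zero]
    rw [e] at h
    exact le_div_of_weighted (by positivity) h
  have hU2 : ∀ σ y, ‖fderiv ℝ (fderiv ℝ (U σ)) y‖ ≤ C / (1 + ‖y‖) ^ 3 := by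
    intro σ y
    have h := h83 σ 2 (by norm_num) y
    have e : ‖iteratedFDeriv ℝ 2 (U σ) y‖ = ‖fderiv ℝ (fderiv ℝ (U σ)) y‖ := by
      rw [← norm_iteratedFDeriv_fderiv, ← norm_iteratedFDeriv_fderiv, norm_iteratedFDeriv_zero]
    rw [e] at h
    exact le_div_of_weighted (by positivity) h
  -- the pressure slices: smooth, and (8.3) for `P` at orders 1..4 in the weighted form
  have hPs : ∀ σ, ContDiff ℝ ∞ (pressurePotential (U σ)) := fun σ =>
    contDiff_pressurePotential_decay_top (hUs σ) (hU0 σ)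
  have hCP : ∀ (k : ℕ) (A : ℝ), 0 ≤ A → k ≤ 3 →
      (∀ (v : EuclideanSpace ℝ (Fin 3) → EuclideanSpace ℝ (Fin 3)) (C' : ℝ), ContDiff ℝ ∞ v →
        (∀ j ≤ (k + 1) + 2, ∀ y, (1 + ‖y‖) ^ (j + 1) * ‖iteratedFDeriv ℝ j v y‖ ≤ C') →
        ∀ x, ‖iteratedFDeriv ℝ (k + 1) (pressurePotential v) x‖ ≤ A * C' ^ 2 / (1 + ‖x‖) ^ ((k + 1) + 2)) →
      ∀ σ y, (1 + ‖y‖) ^ (k + 1) * ‖iteratedFDeriv ℝ (k + 1) (pressurePotential (U σ)) y‖ ≤ A * C ^ 2 := by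
    intro k A hA0 hk hAk σ y
    have h := hAk (U σ) C (hUs σ) (fun j hj y => h83 σ j (by omega) y) y
    have hw : 0 < 1 + ‖y‖ := by positivity
    have hle : (1 + ‖y‖) ^ (k + 1) * (A * C ^ 2 / (1 + ‖y‖) ^ ((k + 1) + 2)) ≤ A * C ^ 2 := by
      have hq : (1 + ‖y‖) ^ (k + 1) / (1 + ‖y‖) ^ ((k + 1) + 2) ≤ 1 :=
        div_le_one_of_le₀ (pow_le_pow_right₀ (by linarith [norm_nonneg y]) (by omega)) (by positivity)
      calc (1 + ‖y‖) ^ (k + 1) * (A * C ^ 2 / (1 + ‖y‖) ^ ((k + 1) + 2))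
          = A * C ^ 2 * ((1 + ‖y‖) ^ (k + 1) / (1 + ‖y‖) ^ ((k + 1) + 2)) := by ring
        _ ≤ A * C ^ 2 * 1 := mul_le_mul_of_nonneg_left hq (by positivity)
        _ = A * C ^ 2 := mul_one _
    exact (mul_le_mul_of_nonneg_left h (by positivity)).trans hle
  have hCP0 := hCP 0 A₁ hA₁0 (by norm_num) hA₁
  have hCP1 := hCP 1 A₂ hA₂0 (by norm_num) hA₂
  have hCP2 := hCP 2 A₃ hA₃0 (by norm_num) hA₃
  have hCP3 := hCP 3 A₄ hA₄0 (by norm_num) hA₄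
  -- the first display at orders 0..3
  have hV0w : ∀ σ y, ‖iteratedFDeriv ℝ 0 (V σ) y‖ ≤ (1 + |α|) * e₀ / (1 + ‖y‖) ^ (0 + 1) := by
    intro σ y; rw [he₀]
    exact norm_iteratedFDeriv_sliceDeriv_le_of_slice_equation 0 (hUs σ) (hPs σ)
      (fun j hj y => h83 σ j (by omega) y) (hCP0 σ) (heq σ) y
  have hV1w : ∀ σ y, ‖iteratedFDeriv ℝ 1 (V σ) y‖ ≤ (1 + |α|) * e₁ / (1 + ‖y‖) ^ (1 + 1) := by
    intro σ y; rw [he₁]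
    exact norm_iteratedFDeriv_sliceDeriv_le_of_slice_equation 1 (hUs σ) (hPs σ)
      (fun j hj y => h83 σ j (by omega) y) (hCP1 σ) (heq σ) y
  have hV2w : ∀ σ y, ‖iteratedFDeriv ℝ 2 (V σ) y‖ ≤ (1 + |α|) * e₂ / (1 + ‖y‖) ^ (2 + 1) := by
    intro σ y; rw [he₂]
    exact norm_iteratedFDeriv_sliceDeriv_le_of_slice_equation 2 (hUs σ) (hPs σ)
      (fun j hj y => h83 σ j (by omega) y) (hCP2 σ) (heq σ) y
  have hV3w : ∀ σ y, ‖iteratedFDeriv ℝ 3 (V σ) y‖ ≤ (1 + |α|) * e₃ / (1 + ‖y‖) ^ (3 + 1) := by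
    intro σ y; rw [he₃]
    exact norm_iteratedFDeriv_sliceDeriv_le_of_slice_equation 3 (hUs σ) (hPs σ)
      (fun j hj y => h83 σ j (by omega) y) (hCP3 σ) (heq σ) y
  -- `fderiv` forms
  have hV0 : ∀ σ y, ‖V σ y‖ ≤ (1 + |α|) * e₀ / (1 + ‖y‖) := by
    intro σ y; have h := hV0w σ y
    rw [norm_iteratedFDeriv_zero, zero_add, pow_one] at h; exact h
  have hV1 : ∀ σ y, ‖fderiv ℝ (V σ) y‖ ≤ (1 + |α|) * e₁ / (1 + ‖y‖) ^ 2 := by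
    intro σ y; have h := hV1w σ y
    have e : ‖iteratedFDeriv ℝ 1 (V σ) y‖ = ‖fderiv ℝ (V σ) y‖ := by
      rw [← norm_iteratedFDeriv_fderiv, norm_iteratedFDeriv_zero]
    rw [e] at h; exact h
  have hV2 : ∀ σ y, ‖fderiv ℝ (fderiv ℝ (V σ)) y‖ ≤ (1 + |α|) * e₂ / (1 + ‖y‖) ^ 3 := by
    intro σ y; have h := hV2w σ y
    have e : ‖iteratedFDeriv ℝ 2 (V σ) y‖ = ‖fderiv ℝ (fderiv ℝ (V σ)) y‖ := by
      rw [← norm_iteratedFDeriv_fderiv, ← norm_iteratedFDeriv_fderiv, norm_iteratedFDeriv_zero]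
    rw [e] at h; exact h
  -- a common weighted bound for `V` up to order 3 (input of the second display at `k = 1`)
  have hVE : ∀ σ, ∀ j ≤ 3, ∀ y, (1 + ‖y‖) ^ (j + 1) * ‖iteratedFDeriv ℝ j (V σ) y‖ ≤
      (1 + |α|) * (e₀ + e₁ + e₂ + e₃) := by
    intro σ j hj y
    interval_cases j
    · exact (weighted_of_le_div (by positivity) (hV0w σ y)).trans
        (mul_le_mul_of_nonneg_left (by linarith) ha1)
    · exact (weighted_of_le_div (by positivity) (hV1w σ y)).trans
        (mul_le_mul_of_nonneg_left (by linarith) ha1)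
    · exact (weighted_of_le_div (by positivity) (hV2w σ y)).trans
        (mul_le_mul_of_nonneg_left (by linarith) ha1)
    · exact (weighted_of_le_div (by positivity) (hV3w σ y)).trans
        (mul_le_mul_of_nonneg_left (by linarith) ha1)
  -- the second display at `k = 1`: `|∇∂ₛP| = 2|D Qˢ[V,U]| ≤ 2 B₁ E_V C (1+|y|)⁻³`
  have hQs : ∀ σ, ContDiff ℝ ∞ (pressurePotentialSym (V σ) (U σ)) := by
    intro σ
    have hp := contDiff_pressurePotential_decay_top ((hVs σ).add (hUs σ)) (C' := (1 + |α|) * e₀ + C)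
      fun y => by
        rw [add_div]
        exact (norm_add_le (V σ y) (U σ y)).trans (add_le_add (hV0 σ y) (hU0 σ y))
    have hm := contDiff_pressurePotential_decay_top ((hVs σ).sub (hUs σ)) (C' := (1 + |α|) * e₀ + C)
      fun y => by
        rw [add_div]
        exact (norm_sub_le (V σ y) (U σ y)).trans (add_le_add (hV0 σ y) (hU0 σ y))
    have he : pressurePotentialSym (V σ) (U σ) =
        fun y => 4⁻¹ * (pressurePotential (V σ + U σ) y - pressurePotential (V σ - U σ) y) := by
      funext y
      rw [pressurePotential_add_sub ((hVs σ).of_le (by norm_cast)) ((hUs σ).of_le (by norm_cast))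
        (hV0 σ) (hU0 σ) y]
      ring
    rw [he]
    exact contDiff_const.mul (hp.sub hm)
  have hDP : ∀ σ y, ‖gradient (fun y => 2 * pressurePotentialSym (V σ) (U σ) y) y‖ ≤
      2 * B₁ * ((1 + |α|) * (e₀ + e₁ + e₂ + e₃)) * C / (1 + ‖y‖) := by
    intro σ y
    have hd : DifferentiableAt ℝ (pressurePotentialSym (V σ) (U σ)) y :=
      ((hQs σ).differentiable (by simp)).differentiableAt
    have hg : gradient (fun y => 2 * pressurePotentialSym (V σ) (U σ) y) y =
        (InnerProductSpace.toDual ℝ (EuclideanSpace ℝ (Fin 3))).symm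
          ((2 : ℝ) • fderiv ℝ (pressurePotentialSym (V σ) (U σ)) y) := by
      rw [gradient, fderiv_const_mul hd]
    rw [hg, LinearIsometryEquiv.norm_map, norm_smul, Real.norm_eq_abs, abs_of_pos two_pos]
    have h := hB₁ (V σ) (U σ) ((1 + |α|) * (e₀ + e₁ + e₂ + e₃)) C (hVs σ) (hUs σ) (hVE σ)
      (fun j hj y => h83 σ j (by omega) y) y
    have hw : 0 < 1 + ‖y‖ := by positivity
    have hnum : 0 ≤ B₁ * ((1 + |α|) * (e₀ + e₁ + e₂ + e₃)) * C := by positivity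
    calc 2 * ‖fderiv ℝ (pressurePotentialSym (V σ) (U σ)) y‖
        ≤ 2 * (B₁ * ((1 + |α|) * (e₀ + e₁ + e₂ + e₃)) * C / (1 + ‖y‖) ^ 3) :=
          mul_le_mul_of_nonneg_left h (by norm_num)
      _ ≤ 2 * (B₁ * ((1 + |α|) * (e₀ + e₁ + e₂ + e₃)) * C / (1 + ‖y‖)) := by
          refine mul_le_mul_of_nonneg_left (div_le_div_of_nonneg_left hnum hw ?_) (by norm_num)
          nlinarith [norm_nonneg y, sq_nonneg ‖y‖, mul_nonneg (norm_nonneg y) (sq_nonneg ‖y‖)]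
      _ = 2 * B₁ * ((1 + |α|) * (e₀ + e₁ + e₂ + e₃)) * C / (1 + ‖y‖) := by ring
  -- `∂ₛ` applied to the equation
  have hone : ∀ y : EuclideanSpace ℝ (Fin 3), C / (1 + ‖y‖) ≤ C := fun y =>
    div_le_self hC0 (by linarith [norm_nonneg y])
  have hK : ∀ σ y, ‖U σ y‖ ≤ C ∧ ‖fderiv ℝ (U σ) y‖ ≤ C ∧ ‖fderiv ℝ (fderiv ℝ (U σ)) y‖ ≤ C :=
    fun σ y => ⟨(hU0 σ y).trans (hone y),
      (hU1 σ y).trans (div_one_add_pow_le_self hC0 (norm_nonneg y) 2),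
      (hU2 σ y).trans (div_one_add_pow_le_self hC0 (norm_nonneg y) 3)⟩
  have hE3 : 0 ≤ (1 + |α|) * (e₀ + e₁ + e₂) := by positivity
  have hK' : ∀ σ y, ‖V σ y‖ ≤ (1 + |α|) * (e₀ + e₁ + e₂) ∧
      ‖fderiv ℝ (V σ) y‖ ≤ (1 + |α|) * (e₀ + e₁ + e₂) ∧
      ‖fderiv ℝ (fderiv ℝ (V σ)) y‖ ≤ (1 + |α|) * (e₀ + e₁ + e₂) := by
    intro σ y
    have hy : 0 ≤ ‖y‖ := norm_nonneg y
    refine ⟨(hV0 σ y).trans ?_, (hV1 σ y).trans ?_, (hV2 σ y).trans ?_⟩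
    · exact (div_le_self (by positivity) (by linarith)).trans
        (mul_le_mul_of_nonneg_left (by linarith) ha1)
    · exact (div_one_add_pow_le_self (by positivity) hy 2).trans
        (mul_le_mul_of_nonneg_left (by linarith) ha1)
    · exact (div_one_add_pow_le_self (by positivity) hy 3).trans
        (mul_le_mul_of_nonneg_left (by linarith) ha1)
  have hds := dslice_equation_of_isSmoothSpaceTimeOn hU hV hW hU0 hV0 hK hK' heq
  -- the third display, `k = 0`
  have hU1' : ∀ σ y, ‖fderiv ℝ (U σ) y‖ ≤ C / (1 + ‖y‖ ^ 2) := fun σ y =>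
    (hU1 σ y).trans (div_le_div_of_nonneg_left hC0 (by positivity)
      (one_add_sq_le_sq_one_add (norm_nonneg y)))
  have hV1' : ∀ σ y, ‖fderiv ℝ (V σ) y‖ ≤ (1 + |α|) * e₁ / (1 + ‖y‖ ^ 2) := fun σ y =>
    (hV1 σ y).trans (div_le_div_of_nonneg_left (by positivity) (by positivity)
      (one_add_sq_le_sq_one_add (norm_nonneg y)))
  have hV2' : ∀ σ y, ‖fderiv ℝ (fderiv ℝ (V σ)) y‖ ≤ (1 + |α|) * e₂ / (1 + ‖y‖ ^ 3) := fun σ y =>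
    (hV2 σ y).trans (div_le_div_of_nonneg_left (by positivity) (by positivity)
      (one_add_cube_le_cube_one_add (norm_nonneg y)))
  have hW0 : ∀ σ y, ‖W σ y‖ ≤ (1 + |α|) * ((1 + |α|) * e₀ + 2 * ((1 + |α|) * e₁) +
      6 * ((1 + |α|) * e₂) + C * ((1 + |α|) * e₀) + C * ((1 + |α|) * e₁) +
        2 * B₁ * ((1 + |α|) * (e₀ + e₁ + e₂ + e₃)) * C) / (1 + ‖y‖) := fun σ y =>
    norm_sliceDeriv2_le_of_dslice_equation ((hVs σ).of_le (by norm_cast)) (hU0 σ) (hU1' σ)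
      (hV0 σ) (hV1' σ) (hV2' σ) (hDP σ) (hds σ) y
  -- Poincaré in `s`
  intro σ y
  have hper' : Function.Periodic (fun s => U s y) S := fun s => hper s y
  have h := norm_deriv_le_of_periodic hS hper' (fun s => h0 s y) (fun s => h0' s y)
    (fun s => hW0 s y) σ
  refine h.trans (le_of_eq ?_)
  have hw : (1 + ‖y‖) ≠ 0 := by positivity
  field_simp

/-- `D²φ(x)[v, v] = D(Dφ · v)(x) v`. [folklore] -/
private theorem iteratedFDeriv_two_apply_self_pv {F : Type*} [NormedAddCommGroup F] [NormedSpace ℝ F]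
    {φ : EuclideanSpace ℝ (Fin 3) → F} (hφ : ContDiff ℝ 2 φ) (x v : EuclideanSpace ℝ (Fin 3)) :
    iteratedFDeriv ℝ 2 φ x ![v, v] = fderiv ℝ (fun y => fderiv ℝ φ y v) x v := by
  have hd : DifferentiableAt ℝ (fderiv ℝ φ) x :=
    ((hφ.fderiv_right (m := 1) le_rfl).differentiable one_ne_zero) x
  rw [iteratedFDeriv_two_apply, fderiv_clm_apply hd (differentiableAt_const v)]
  simp

/-- `‖Dᵏ(Δf)(x)‖ ≤ 3 ‖Dᵏ⁺²f(x)‖` on `ℝ³` (frame expansion; copy of the private lemma of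
`PineauVicolSliceDerivativeBounds`). [folklore] -/
private theorem norm_iteratedFDeriv_laplacian_le_three_pv {F : Type*} [NormedAddCommGroup F]
    [NormedSpace ℝ F] {f : EuclideanSpace ℝ (Fin 3) → F} (hf : ContDiff ℝ ∞ f) (k : ℕ) (x : EuclideanSpace ℝ (Fin 3)) :
    ‖iteratedFDeriv ℝ k (Δ f) x‖ ≤ 3 * ‖iteratedFDeriv ℝ (k + 2) f x‖ := by
  set b := stdOrthonormalBasis ℝ (EuclideanSpace ℝ (Fin 3)) with hb
  have hkᵢ : ∀ i, ContDiff ℝ ∞ fun y => fderiv ℝ f y (b i) := fun i =>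
    (hf.fderiv_right (m := ∞) (by exact_mod_cast le_rfl)).clm_apply contDiff_const
  have hgᵢ : ∀ i, ContDiff ℝ ∞ fun y => fderiv ℝ (fun z => fderiv ℝ f z (b i)) y (b i) := fun i =>
    ((hkᵢ i).fderiv_right (m := ∞) (by exact_mod_cast le_rfl)).clm_apply contDiff_const
  have hΔ : Δ f = fun y => ∑ i, fderiv ℝ (fun z => fderiv ℝ f z (b i)) y (b i) := by
    rw [laplacian_eq_iteratedFDeriv_orthonormalBasis f b]
    funext y
    exact Finset.sum_congr rfl fun i _ =>
      iteratedFDeriv_two_apply_self_pv (contDiff_infty.1 hf 2) y (b i)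
  rw [hΔ, iteratedFDeriv_fun_sum_apply fun i _ => (hgᵢ i).contDiffAt.of_le (by exact_mod_cast le_top)]
  have hcard : Fintype.card (Fin (Module.finrank ℝ (EuclideanSpace ℝ (Fin 3)))) = 3 := by
    rw [Fintype.card_fin, finrank_euclideanSpace_fin]
  calc ‖∑ i, iteratedFDeriv ℝ k (fun y => fderiv ℝ (fun z => fderiv ℝ f z (b i)) y (b i)) x‖
      ≤ ∑ i, ‖iteratedFDeriv ℝ k (fun y => fderiv ℝ (fun z => fderiv ℝ f z (b i)) y (b i)) x‖ :=
        norm_sum_le _ _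
    _ ≤ ∑ _i : Fin (Module.finrank ℝ (EuclideanSpace ℝ (Fin 3))), ‖iteratedFDeriv ℝ (k + 2) f x‖ :=
        Finset.sum_le_sum fun i _ => by
          have h1 := norm_iteratedFDeriv_clm_apply_const
            (((hkᵢ i).fderiv_right (m := ∞) (by exact_mod_cast le_rfl)).contDiffAt) (c := b i)
            (n := k) (x := x) (by exact_mod_cast le_top)
          rw [b.orthonormal.1 i, one_mul, norm_iteratedFDeriv_fderiv] at h1
          have h2 := norm_iteratedFDeriv_clm_apply_const
            ((hf.fderiv_right (m := ∞) (by exact_mod_cast le_rfl)).contDiffAt) (c := b i)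
            (n := k + 1) (x := x) (by exact_mod_cast le_top)
          rw [b.orthonormal.1 i, one_mul, norm_iteratedFDeriv_fderiv] at h2
          exact h1.trans h2
    _ = 3 * ‖iteratedFDeriv ℝ (k + 2) f x‖ := by
        rw [Finset.sum_const, Finset.card_univ, hcard]; simp

/-- `‖Dᵏ∇P(y)‖ ≤ ‖Dᵏ⁺¹P(y)‖` (`toDual` isometry; copy of the private lemma of
`PineauVicolSliceDerivativeBounds`). [folklore] -/
private theorem norm_iteratedFDeriv_gradient_le_pv {P : EuclideanSpace ℝ (Fin 3) → ℝ} (hP : ContDiff ℝ ∞ P)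
    (k : ℕ) (y : EuclideanSpace ℝ (Fin 3)) :
    ‖iteratedFDeriv ℝ k (gradient P) y‖ ≤ ‖iteratedFDeriv ℝ (k + 1) P y‖ := by
  have hgrad : gradient P =
      ((InnerProductSpace.toDual ℝ (EuclideanSpace ℝ (Fin 3))).symm :
        StrongDual ℝ (EuclideanSpace ℝ (Fin 3)) →L[ℝ] EuclideanSpace ℝ (Fin 3)) ∘ (fderiv ℝ P) := by
    funext z; rfl
  have hDP : ContDiff ℝ ∞ (fderiv ℝ P) := hP.fderiv_right (m := ∞) le_rfl
  rw [hgrad]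
  refine (ContinuousLinearMap.norm_iteratedFDeriv_comp_left _ hDP.contDiffAt
    (by exact_mod_cast le_top)).trans ?_
  rw [norm_iteratedFDeriv_fderiv]
  have hn : ‖((InnerProductSpace.toDual ℝ (EuclideanSpace ℝ (Fin 3))).symm :
      StrongDual ℝ (EuclideanSpace ℝ (Fin 3)) →L[ℝ] EuclideanSpace ℝ (Fin 3))‖ ≤ 1 := by
    refine ContinuousLinearMap.opNorm_le_bound _ zero_le_one fun v => ?_
    rw [one_mul]
    exact le_of_eq (LinearIsometryEquiv.norm_map _ _)
  calc _ ≤ 1 * ‖iteratedFDeriv ℝ (k + 1) P y‖ := mul_le_mul_of_nonneg_right hn (norm_nonneg _)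
    _ = _ := one_mul _

-- the assembly below elaborates ~40 intermediate estimates; the default heartbeat budget is too small
set_option maxHeartbeats 800000 in
/-- **Pineau–Vicol 2026, Lemma 8.1 (8.2), second half — for an abstract jointly smooth `S`-periodic
family solving (1.14a) with `P = RᵢRⱼ(UᵢUⱼ)` on every slice**: `|∇∂ₛU(y,s)| ≤ C_s′ S (1+|α|)²/(1+|y|)²`
(hence `≤ C_s′ S (1+|α|)²/(1+|y|²)` as printed), under (8.3) for `U` with one constant `C` at the
orders `j ≤ 7`. Same assembly as `exists_norm_sliceDeriv_le_of_periodic`, with the first display up to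
`k = 4`, the second display at `k = 2` and the `k = 1` twin of the third display
(`norm_fderiv_sliceDeriv2_le_of_dslice_equation`), closed by Poincaré in `s` for the curve
`s ↦ D U(s,·)(y)` in `ℝ³ →L ℝ³`. DEVIATION: `C_s′` depends on `C` (orders `≤ 7`).
[cite: PineauVicol2026, Lemma 8.1 (8.2) and its proof (p. 28)] -/
theorem exists_norm_fderiv_sliceDeriv_le_of_periodic (C : ℝ) :
    ∃ Cs : ℝ, ∀ (U V : ℝ → EuclideanSpace ℝ (Fin 3) → EuclideanSpace ℝ (Fin 3)) (α S : ℝ), 0 < S → IsSmoothSpaceTimeOn Set.univ U →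
      (V = fun σ y => deriv (fun τ => U τ y) σ) → (∀ σ y, U (σ + S) y = U σ y) →
      (∀ σ, ∀ j ≤ 7, ∀ y, (1 + ‖y‖) ^ (j + 1) * ‖iteratedFDeriv ℝ j (U σ) y‖ ≤ C) →
      (∀ σ y, α • (rotGen (U σ y) - fderiv ℝ (U σ) y (rotGen y)) + (1 / 2 : ℝ) • U σ y +
        (1 / 2 : ℝ) • fderiv ℝ (U σ) y y - (Δ (U σ)) y + convect (U σ) (U σ) y +
          gradient (pressurePotential (U σ)) y + V σ y = 0) →
      ∀ σ y, ‖fderiv ℝ (V σ) y‖ ≤ Cs * S * (1 + |α|) ^ 2 / (1 + ‖y‖) ^ 2 := by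
  obtain ⟨A₁, hA₁0, hA₁⟩ := exists_bound_norm_iteratedFDeriv_pressurePotential_decay 1
  obtain ⟨A₂, hA₂0, hA₂⟩ := exists_bound_norm_iteratedFDeriv_pressurePotential_decay 2
  obtain ⟨A₃, hA₃0, hA₃⟩ := exists_bound_norm_iteratedFDeriv_pressurePotential_decay 3
  obtain ⟨A₄, hA₄0, hA₄⟩ := exists_bound_norm_iteratedFDeriv_pressurePotential_decay 4
  obtain ⟨A₅, hA₅0, hA₅⟩ := exists_bound_norm_iteratedFDeriv_pressurePotential_decay 5
  obtain ⟨B₁, hB₁0, hB₁⟩ := exists_bound_norm_fderiv_pressurePotentialSym_decay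
  obtain ⟨B₂, hB₂0, hB₂⟩ := exists_bound_norm_fderiv2_pressurePotentialSym_decay
  obtain ⟨e₀, he₀⟩ : ∃ e : ℝ, e = (2 ^ 0 + 4) * C + 2 ^ 0 * C ^ 2 + A₁ * C ^ 2 := ⟨_, rfl⟩
  obtain ⟨e₁, he₁⟩ : ∃ e : ℝ, e = (2 ^ 1 + 4) * C + 2 ^ 1 * C ^ 2 + A₂ * C ^ 2 := ⟨_, rfl⟩
  obtain ⟨e₂, he₂⟩ : ∃ e : ℝ, e = (2 ^ 2 + 4) * C + 2 ^ 2 * C ^ 2 + A₃ * C ^ 2 := ⟨_, rfl⟩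
  obtain ⟨e₃, he₃⟩ : ∃ e : ℝ, e = (2 ^ 3 + 4) * C + 2 ^ 3 * C ^ 2 + A₄ * C ^ 2 := ⟨_, rfl⟩
  obtain ⟨e₄, he₄⟩ : ∃ e : ℝ, e = (2 ^ 4 + 4) * C + 2 ^ 4 * C ^ 2 + A₅ * C ^ 2 := ⟨_, rfl⟩
  -- the constant: `(1+|α|)⁻² × [third display, k = 1]/2`
  refine ⟨(4 * e₁ + 3 * e₂ + 3 * e₃ + 4 * C * e₁ + 2 * C * e₀ + 2 * C * e₂ +
    2 * B₂ * (e₀ + e₁ + e₂ + e₃ + e₄) * C) / 2, ?_⟩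
  intro U V α S hS hU hV hper h83 heq
  have ha : 0 ≤ |α| := abs_nonneg α
  have ha1 : 0 ≤ 1 + |α| := by positivity
  have hC0 : 0 ≤ C := by
    have h := h83 0 0 (by norm_num) 0
    rw [pow_one] at h
    exact le_trans (by positivity) h
  have he₀0 : 0 ≤ e₀ := by rw [he₀]; positivity
  have he₁0 : 0 ≤ e₁ := by rw [he₁]; positivity
  have he₂0 : 0 ≤ e₂ := by rw [he₂]; positivity
  have he₃0 : 0 ≤ e₃ := by rw [he₃]; positivity
  have he₄0 : 0 ≤ e₄ := by rw [he₄]; positivity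
  -- smoothness of the families and slices, jet-wise `σ`-derivatives
  have hUs : ∀ σ, ContDiff ℝ ∞ (U σ) := fun σ => hU.contDiff_slice (Set.mem_univ σ)
  have hU' : IsSmoothSpaceTimeOn Set.univ V := by
    rw [hV]; exact hU.isSmoothSpaceTimeOn_deriv isOpen_univ
  have hVs : ∀ σ, ContDiff ℝ ∞ (V σ) := fun σ => hU'.contDiff_slice (Set.mem_univ σ)
  obtain ⟨W, hW⟩ : ∃ W : ℝ → EuclideanSpace ℝ (Fin 3) → EuclideanSpace ℝ (Fin 3), W = fun σ y => deriv (fun τ => V τ y) σ := ⟨_, rfl⟩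
  have h1 : ∀ τ y, HasDerivAt (fun τ' => fderiv ℝ (U τ') y) (fderiv ℝ (V τ) y) τ := by
    intro τ y
    have h := hU.hasDerivAt_fderiv_slice_clm isOpen_univ (Set.mem_univ τ) y
    rw [hV]; exact h
  have h1' : ∀ τ y, HasDerivAt (fun τ' => fderiv ℝ (V τ') y) (fderiv ℝ (W τ) y) τ := by
    intro τ y
    have h := hU'.hasDerivAt_fderiv_slice_clm isOpen_univ (Set.mem_univ τ) y
    rw [hW]; exact h
  -- (8.3) for `U`, orders 0, 1, 2, in `fderiv` form
  have hU0 : ∀ σ y, ‖U σ y‖ ≤ C / (1 + ‖y‖) := by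
    intro σ y
    have h := h83 σ 0 (by norm_num) y
    rw [norm_iteratedFDeriv_zero, zero_add, pow_one] at h
    exact le_div_of_weighted (by positivity) h
  have hU1 : ∀ σ y, ‖fderiv ℝ (U σ) y‖ ≤ C / (1 + ‖y‖) ^ 2 := by
    intro σ y
    have h := h83 σ 1 (by norm_num) y
    have e : ‖iteratedFDeriv ℝ 1 (U σ) y‖ = ‖fderiv ℝ (U σ) y‖ := by
      rw [← norm_iteratedFDeriv_fderiv, norm_iteratedFDeriv_zero]
    rw [e] at h
    exact le_div_of_weighted (by positivity) h
  have hU2 : ∀ σ y, ‖fderiv ℝ (fderiv ℝ (U σ)) y‖ ≤ C / (1 + ‖y‖) ^ 3 := by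
    intro σ y
    have h := h83 σ 2 (by norm_num) y
    have e : ‖iteratedFDeriv ℝ 2 (U σ) y‖ = ‖fderiv ℝ (fderiv ℝ (U σ)) y‖ := by
      rw [← norm_iteratedFDeriv_fderiv, ← norm_iteratedFDeriv_fderiv, norm_iteratedFDeriv_zero]
    rw [e] at h
    exact le_div_of_weighted (by positivity) h
  -- the pressure slices and (8.3) for `P` at orders 1..5
  have hPs : ∀ σ, ContDiff ℝ ∞ (pressurePotential (U σ)) := fun σ =>
    contDiff_pressurePotential_decay_top (hUs σ) (hU0 σ)
  have hCP : ∀ (k : ℕ) (A : ℝ), 0 ≤ A → k ≤ 4 →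
      (∀ (v : EuclideanSpace ℝ (Fin 3) → EuclideanSpace ℝ (Fin 3)) (C' : ℝ), ContDiff ℝ ∞ v →
        (∀ j ≤ (k + 1) + 2, ∀ y, (1 + ‖y‖) ^ (j + 1) * ‖iteratedFDeriv ℝ j v y‖ ≤ C') →
        ∀ x, ‖iteratedFDeriv ℝ (k + 1) (pressurePotential v) x‖ ≤ A * C' ^ 2 / (1 + ‖x‖) ^ ((k + 1) + 2)) →
      ∀ σ y, (1 + ‖y‖) ^ (k + 1) * ‖iteratedFDeriv ℝ (k + 1) (pressurePotential (U σ)) y‖ ≤ A * C ^ 2 := by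
    intro k A hA0 hk hAk σ y
    have h := hAk (U σ) C (hUs σ) (fun j hj y => h83 σ j (by omega) y) y
    have hle : (1 + ‖y‖) ^ (k + 1) * (A * C ^ 2 / (1 + ‖y‖) ^ ((k + 1) + 2)) ≤ A * C ^ 2 := by
      have hq : (1 + ‖y‖) ^ (k + 1) / (1 + ‖y‖) ^ ((k + 1) + 2) ≤ 1 :=
        div_le_one_of_le₀ (pow_le_pow_right₀ (by linarith [norm_nonneg y]) (by omega)) (by positivity)
      calc (1 + ‖y‖) ^ (k + 1) * (A * C ^ 2 / (1 + ‖y‖) ^ ((k + 1) + 2))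
          = A * C ^ 2 * ((1 + ‖y‖) ^ (k + 1) / (1 + ‖y‖) ^ ((k + 1) + 2)) := by ring
        _ ≤ A * C ^ 2 * 1 := mul_le_mul_of_nonneg_left hq (by positivity)
        _ = A * C ^ 2 := mul_one _
    exact (mul_le_mul_of_nonneg_left h (by positivity)).trans hle
  have hCP0 := hCP 0 A₁ hA₁0 (by norm_num) hA₁
  have hCP1 := hCP 1 A₂ hA₂0 (by norm_num) hA₂
  have hCP2 := hCP 2 A₃ hA₃0 (by norm_num) hA₃
  have hCP3 := hCP 3 A₄ hA₄0 (by norm_num) hA₄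
  have hCP4 := hCP 4 A₅ hA₅0 (by norm_num) hA₅
  -- the first display at orders 0..4
  have hV0w : ∀ σ y, ‖iteratedFDeriv ℝ 0 (V σ) y‖ ≤ (1 + |α|) * e₀ / (1 + ‖y‖) ^ (0 + 1) := by
    intro σ y; rw [he₀]
    exact norm_iteratedFDeriv_sliceDeriv_le_of_slice_equation 0 (hUs σ) (hPs σ)
      (fun j hj y => h83 σ j (by omega) y) (hCP0 σ) (heq σ) y
  have hV1w : ∀ σ y, ‖iteratedFDeriv ℝ 1 (V σ) y‖ ≤ (1 + |α|) * e₁ / (1 + ‖y‖) ^ (1 + 1) := by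
    intro σ y; rw [he₁]
    exact norm_iteratedFDeriv_sliceDeriv_le_of_slice_equation 1 (hUs σ) (hPs σ)
      (fun j hj y => h83 σ j (by omega) y) (hCP1 σ) (heq σ) y
  have hV2w : ∀ σ y, ‖iteratedFDeriv ℝ 2 (V σ) y‖ ≤ (1 + |α|) * e₂ / (1 + ‖y‖) ^ (2 + 1) := by
    intro σ y; rw [he₂]
    exact norm_iteratedFDeriv_sliceDeriv_le_of_slice_equation 2 (hUs σ) (hPs σ)
      (fun j hj y => h83 σ j (by omega) y) (hCP2 σ) (heq σ) y
  have hV3w : ∀ σ y, ‖iteratedFDeriv ℝ 3 (V σ) y‖ ≤ (1 + |α|) * e₃ / (1 + ‖y‖) ^ (3 + 1) := by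
    intro σ y; rw [he₃]
    exact norm_iteratedFDeriv_sliceDeriv_le_of_slice_equation 3 (hUs σ) (hPs σ)
      (fun j hj y => h83 σ j (by omega) y) (hCP3 σ) (heq σ) y
  have hV4w : ∀ σ y, ‖iteratedFDeriv ℝ 4 (V σ) y‖ ≤ (1 + |α|) * e₄ / (1 + ‖y‖) ^ (4 + 1) := by
    intro σ y; rw [he₄]
    exact norm_iteratedFDeriv_sliceDeriv_le_of_slice_equation 4 (hUs σ) (hPs σ)
      (fun j hj y => h83 σ j (by omega) y) (hCP4 σ) (heq σ) y
  have hV0 : ∀ σ y, ‖V σ y‖ ≤ (1 + |α|) * e₀ / (1 + ‖y‖) := by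
    intro σ y; have h := hV0w σ y
    rw [norm_iteratedFDeriv_zero, zero_add, pow_one] at h; exact h
  have hV1 : ∀ σ y, ‖fderiv ℝ (V σ) y‖ ≤ (1 + |α|) * e₁ / (1 + ‖y‖) ^ 2 := by
    intro σ y; have h := hV1w σ y
    have e : ‖iteratedFDeriv ℝ 1 (V σ) y‖ = ‖fderiv ℝ (V σ) y‖ := by
      rw [← norm_iteratedFDeriv_fderiv, norm_iteratedFDeriv_zero]
    rw [e] at h; exact h
  have hV2 : ∀ σ y, ‖fderiv ℝ (fderiv ℝ (V σ)) y‖ ≤ (1 + |α|) * e₂ / (1 + ‖y‖) ^ 3 := by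
    intro σ y; have h := hV2w σ y
    have e : ‖iteratedFDeriv ℝ 2 (V σ) y‖ = ‖fderiv ℝ (fderiv ℝ (V σ)) y‖ := by
      rw [← norm_iteratedFDeriv_fderiv, ← norm_iteratedFDeriv_fderiv, norm_iteratedFDeriv_zero]
    rw [e] at h; exact h
  -- `|D(ΔV)| ≤ 3|D³V| ≤ 3(1+|α|)e₃ (1+|y|)⁻⁴ ≤ … (1+|y|)⁻²`
  have hV3 : ∀ σ y, ‖fderiv ℝ (Δ (V σ)) y‖ ≤ 3 * ((1 + |α|) * e₃) / (1 + ‖y‖) ^ 2 := by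
    intro σ y
    have h := norm_iteratedFDeriv_laplacian_le_three_pv (hVs σ) 1 y
    rw [← norm_iteratedFDeriv_fderiv, norm_iteratedFDeriv_zero] at h
    refine h.trans ?_
    have h3 := hV3w σ y
    have hw : 0 < 1 + ‖y‖ := by positivity
    calc 3 * ‖iteratedFDeriv ℝ (1 + 2) (V σ) y‖ ≤ 3 * ((1 + |α|) * e₃ / (1 + ‖y‖) ^ (3 + 1)) :=
          mul_le_mul_of_nonneg_left h3 (by norm_num)
      _ ≤ 3 * ((1 + |α|) * e₃ / (1 + ‖y‖) ^ 2) := by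
          refine mul_le_mul_of_nonneg_left (div_le_div_of_nonneg_left (by positivity) (by positivity)
            (pow_le_pow_right₀ (by linarith [norm_nonneg y]) (by norm_num))) (by norm_num)
      _ = 3 * ((1 + |α|) * e₃) / (1 + ‖y‖) ^ 2 := by ring
  -- a common weighted bound for `V` up to order 4 (input of the second display at `k = 2`)
  have hVE : ∀ σ, ∀ j ≤ 4, ∀ y, (1 + ‖y‖) ^ (j + 1) * ‖iteratedFDeriv ℝ j (V σ) y‖ ≤
      (1 + |α|) * (e₀ + e₁ + e₂ + e₃ + e₄) := by
    intro σ j hj y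
    interval_cases j
    · exact (weighted_of_le_div (by positivity) (hV0w σ y)).trans
        (mul_le_mul_of_nonneg_left (by linarith) ha1)
    · exact (weighted_of_le_div (by positivity) (hV1w σ y)).trans
        (mul_le_mul_of_nonneg_left (by linarith) ha1)
    · exact (weighted_of_le_div (by positivity) (hV2w σ y)).trans
        (mul_le_mul_of_nonneg_left (by linarith) ha1)
    · exact (weighted_of_le_div (by positivity) (hV3w σ y)).trans
        (mul_le_mul_of_nonneg_left (by linarith) ha1)
    · exact (weighted_of_le_div (by positivity) (hV4w σ y)).trans
        (mul_le_mul_of_nonneg_left (by linarith) ha1)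
  -- `P′ = 2Qˢ[V, U]` is smooth; the second display at `k = 1` and `k = 2`
  have hQs : ∀ σ, ContDiff ℝ ∞ (pressurePotentialSym (V σ) (U σ)) := by
    intro σ
    have hp := contDiff_pressurePotential_decay_top ((hVs σ).add (hUs σ)) (C' := (1 + |α|) * e₀ + C)
      fun y => by
        rw [add_div]
        exact (norm_add_le (V σ y) (U σ y)).trans (add_le_add (hV0 σ y) (hU0 σ y))
    have hm := contDiff_pressurePotential_decay_top ((hVs σ).sub (hUs σ)) (C' := (1 + |α|) * e₀ + C)
      fun y => by
        rw [add_div]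
        exact (norm_sub_le (V σ y) (U σ y)).trans (add_le_add (hV0 σ y) (hU0 σ y))
    have he : pressurePotentialSym (V σ) (U σ) =
        fun y => 4⁻¹ * (pressurePotential (V σ + U σ) y - pressurePotential (V σ - U σ) y) := by
      funext y
      rw [pressurePotential_add_sub ((hVs σ).of_le (by norm_cast)) ((hUs σ).of_le (by norm_cast))
        (hV0 σ) (hU0 σ) y]
      ring
    rw [he]
    exact contDiff_const.mul (hp.sub hm)
  have hP's : ∀ σ, ContDiff ℝ ∞ (fun y => 2 * pressurePotentialSym (V σ) (U σ) y) := fun σ =>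
    contDiff_const.mul (hQs σ)
  have hDP : ∀ σ y, ‖gradient (fun y => 2 * pressurePotentialSym (V σ) (U σ) y) y‖ ≤
      2 * B₁ * ((1 + |α|) * (e₀ + e₁ + e₂ + e₃ + e₄)) * C / (1 + ‖y‖) := by
    intro σ y
    have hd : DifferentiableAt ℝ (pressurePotentialSym (V σ) (U σ)) y :=
      ((hQs σ).differentiable (by simp)).differentiableAt
    have hg : gradient (fun y => 2 * pressurePotentialSym (V σ) (U σ) y) y =
        (InnerProductSpace.toDual ℝ (EuclideanSpace ℝ (Fin 3))).symm
          ((2 : ℝ) • fderiv ℝ (pressurePotentialSym (V σ) (U σ)) y) := by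
      rw [gradient, fderiv_const_mul hd]
    rw [hg, LinearIsometryEquiv.norm_map, norm_smul, Real.norm_eq_abs, abs_of_pos two_pos]
    have h := hB₁ (V σ) (U σ) ((1 + |α|) * (e₀ + e₁ + e₂ + e₃ + e₄)) C (hVs σ) (hUs σ)
      (fun j hj y => hVE σ j (by omega) y) (fun j hj y => h83 σ j (by omega) y) y
    have hw : 0 < 1 + ‖y‖ := by positivity
    have hnum : 0 ≤ B₁ * ((1 + |α|) * (e₀ + e₁ + e₂ + e₃ + e₄)) * C := by positivity
    calc 2 * ‖fderiv ℝ (pressurePotentialSym (V σ) (U σ)) y‖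
        ≤ 2 * (B₁ * ((1 + |α|) * (e₀ + e₁ + e₂ + e₃ + e₄)) * C / (1 + ‖y‖) ^ 3) :=
          mul_le_mul_of_nonneg_left h (by norm_num)
      _ ≤ 2 * (B₁ * ((1 + |α|) * (e₀ + e₁ + e₂ + e₃ + e₄)) * C / (1 + ‖y‖)) := by
          refine mul_le_mul_of_nonneg_left (div_le_div_of_nonneg_left hnum hw ?_) (by norm_num)
          nlinarith [norm_nonneg y, sq_nonneg ‖y‖, mul_nonneg (norm_nonneg y) (sq_nonneg ‖y‖)]
      _ = 2 * B₁ * ((1 + |α|) * (e₀ + e₁ + e₂ + e₃ + e₄)) * C / (1 + ‖y‖) := by ring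
  have hDP2 : ∀ σ y, ‖fderiv ℝ (gradient (fun y => 2 * pressurePotentialSym (V σ) (U σ) y)) y‖ ≤
      2 * B₂ * ((1 + |α|) * (e₀ + e₁ + e₂ + e₃ + e₄)) * C / (1 + ‖y‖) ^ 2 := by
    intro σ y
    have h := norm_iteratedFDeriv_gradient_le_pv (hP's σ) 1 y
    rw [← norm_iteratedFDeriv_fderiv, norm_iteratedFDeriv_zero] at h
    refine h.trans ?_
    have e2 : iteratedFDeriv ℝ (1 + 1) (fun y => 2 * pressurePotentialSym (V σ) (U σ) y) y =
        (2 : ℝ) • iteratedFDeriv ℝ (1 + 1) (pressurePotentialSym (V σ) (U σ)) y := by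
      have hQn : ∀ n : ℕ, ContDiffAt ℝ n (pressurePotentialSym (V σ) (U σ)) y := fun n =>
        (hQs σ).contDiffAt.of_le (by exact_mod_cast le_top)
      have := iteratedFDeriv_const_smul_apply' (𝕜 := ℝ) (a := (2 : ℝ))
        (f := pressurePotentialSym (V σ) (U σ)) (x := y) (i := 1 + 1) (hQn (1 + 1))
      simpa [smul_eq_mul] using this
    rw [e2, norm_smul, Real.norm_eq_abs, abs_of_pos two_pos]
    have hb := hB₂ (V σ) (U σ) ((1 + |α|) * (e₀ + e₁ + e₂ + e₃ + e₄)) C (hVs σ) (hUs σ) (hVE σ)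
      (fun j hj y => h83 σ j (by omega) y) y
    have e2' : ‖iteratedFDeriv ℝ (1 + 1) (pressurePotentialSym (V σ) (U σ)) y‖ =
        ‖fderiv ℝ (fderiv ℝ (pressurePotentialSym (V σ) (U σ))) y‖ := by
      rw [← norm_iteratedFDeriv_fderiv, ← norm_iteratedFDeriv_fderiv, norm_iteratedFDeriv_zero]
    rw [e2']
    have hw : 0 < 1 + ‖y‖ := by positivity
    have hnum : 0 ≤ B₂ * ((1 + |α|) * (e₀ + e₁ + e₂ + e₃ + e₄)) * C := by positivity
    calc 2 * ‖fderiv ℝ (fderiv ℝ (pressurePotentialSym (V σ) (U σ))) y‖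
        ≤ 2 * (B₂ * ((1 + |α|) * (e₀ + e₁ + e₂ + e₃ + e₄)) * C / (1 + ‖y‖) ^ 4) :=
          mul_le_mul_of_nonneg_left hb (by norm_num)
      _ ≤ 2 * (B₂ * ((1 + |α|) * (e₀ + e₁ + e₂ + e₃ + e₄)) * C / (1 + ‖y‖) ^ 2) := by
          refine mul_le_mul_of_nonneg_left (div_le_div_of_nonneg_left hnum (by positivity)
            (pow_le_pow_right₀ (by linarith [norm_nonneg y]) (by norm_num))) (by norm_num)
      _ = 2 * B₂ * ((1 + |α|) * (e₀ + e₁ + e₂ + e₃ + e₄)) * C / (1 + ‖y‖) ^ 2 := by ring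
  -- `∂ₛ` applied to the equation
  have hone : ∀ y : EuclideanSpace ℝ (Fin 3), C / (1 + ‖y‖) ≤ C := fun y =>
    div_le_self hC0 (by linarith [norm_nonneg y])
  have hK : ∀ σ y, ‖U σ y‖ ≤ C ∧ ‖fderiv ℝ (U σ) y‖ ≤ C ∧ ‖fderiv ℝ (fderiv ℝ (U σ)) y‖ ≤ C :=
    fun σ y => ⟨(hU0 σ y).trans (hone y),
      (hU1 σ y).trans (div_one_add_pow_le_self hC0 (norm_nonneg y) 2),
      (hU2 σ y).trans (div_one_add_pow_le_self hC0 (norm_nonneg y) 3)⟩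
  have hK' : ∀ σ y, ‖V σ y‖ ≤ (1 + |α|) * (e₀ + e₁ + e₂) ∧
      ‖fderiv ℝ (V σ) y‖ ≤ (1 + |α|) * (e₀ + e₁ + e₂) ∧
      ‖fderiv ℝ (fderiv ℝ (V σ)) y‖ ≤ (1 + |α|) * (e₀ + e₁ + e₂) := by
    intro σ y
    have hy : 0 ≤ ‖y‖ := norm_nonneg y
    refine ⟨(hV0 σ y).trans ?_, (hV1 σ y).trans ?_, (hV2 σ y).trans ?_⟩
    · exact (div_le_self (by positivity) (by linarith)).trans
        (mul_le_mul_of_nonneg_left (by linarith) ha1)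
    · exact (div_one_add_pow_le_self (by positivity) hy 2).trans
        (mul_le_mul_of_nonneg_left (by linarith) ha1)
    · exact (div_one_add_pow_le_self (by positivity) hy 3).trans
        (mul_le_mul_of_nonneg_left (by linarith) ha1)
  have hds := dslice_equation_of_isSmoothSpaceTimeOn hU hV hW hU0 hV0 hK hK' heq
  -- the third display, `k = 1`
  have hU1' : ∀ σ y, ‖fderiv ℝ (U σ) y‖ ≤ C / (1 + ‖y‖ ^ 2) := fun σ y =>
    (hU1 σ y).trans (div_le_div_of_nonneg_left hC0 (by positivity)
      (one_add_sq_le_sq_one_add (norm_nonneg y)))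
  have hU2' : ∀ σ y, ‖fderiv ℝ (fderiv ℝ (U σ)) y‖ ≤ C / (1 + ‖y‖ ^ 3) := fun σ y =>
    (hU2 σ y).trans (div_le_div_of_nonneg_left hC0 (by positivity)
      (one_add_cube_le_cube_one_add (norm_nonneg y)))
  have hV1' : ∀ σ y, ‖fderiv ℝ (V σ) y‖ ≤ (1 + |α|) * e₁ / (1 + ‖y‖ ^ 2) := fun σ y =>
    (hV1 σ y).trans (div_le_div_of_nonneg_left (by positivity) (by positivity)
      (one_add_sq_le_sq_one_add (norm_nonneg y)))
  have hV2' : ∀ σ y, ‖fderiv ℝ (fderiv ℝ (V σ)) y‖ ≤ (1 + |α|) * e₂ / (1 + ‖y‖ ^ 3) := fun σ y =>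
    (hV2 σ y).trans (div_le_div_of_nonneg_left (by positivity) (by positivity)
      (one_add_cube_le_cube_one_add (norm_nonneg y)))
  have hW1 : ∀ σ y, ‖fderiv ℝ (W σ) y‖ ≤ (1 + |α|) *
      (4 * ((1 + |α|) * e₁) + 3 * ((1 + |α|) * e₂) + 3 * ((1 + |α|) * e₃) +
        4 * C * ((1 + |α|) * e₁) + 2 * C * ((1 + |α|) * e₀) + 2 * C * ((1 + |α|) * e₂) +
        2 * B₂ * ((1 + |α|) * (e₀ + e₁ + e₂ + e₃ + e₄)) * C) / (1 + ‖y‖) ^ 2 := fun σ y =>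
    norm_fderiv_sliceDeriv2_le_of_dslice_equation ((hVs σ).of_le (by norm_cast))
      ((hUs σ).of_le (by norm_cast)) ((hP's σ).of_le (by norm_cast)) (hU0 σ) (hU1' σ) (hU2' σ)
      (hV0 σ) (hV1' σ) (hV2' σ) (hV3 σ) (hDP2 σ) (hds σ) y
  -- Poincaré in `s` for the curve `s ↦ D U(s,·)(y)`
  intro σ y
  have hper' : Function.Periodic (fun s => fderiv ℝ (U s) y) S := by
    intro s
    have e : U (s + S) = U s := funext fun y => hper s y
    show fderiv ℝ (U (s + S)) y = fderiv ℝ (U s) y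
    rw [e]
  have h := norm_deriv_le_of_periodic hS hper' (fun s => h1 s y) (fun s => h1' s y)
    (fun s => hW1 s y) σ
  refine h.trans (le_of_eq ?_)
  have hw : (1 + ‖y‖) ≠ 0 := by positivity
  field_simp

end EightTwo

/-! ### The same with the profile written `U : ℝ³ → ℝ → ℝ³` (space first), as on the summit side -/

section Swap

/-- A family `U : ℝ³ → ℝ → ℝ³` jointly `C^∞` in `(z, s)` is a jointly smooth space–time field in the
order `(s, z)`. [folklore] -/
private theorem isSmoothSpaceTimeOn_univ_swap {U : EuclideanSpace ℝ (Fin 3) → ℝ → EuclideanSpace ℝ (Fin 3)}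
    (hUj : ContDiff ℝ ∞ (fun q : EuclideanSpace ℝ (Fin 3) × ℝ => U q.1 q.2)) :
    IsSmoothSpaceTimeOn Set.univ (fun s y => U y s) := by
  have h : ContDiff ℝ ∞ (uncurry fun s y => U y s) := by
    have e : (uncurry fun s y => U y s) =
        (fun q : EuclideanSpace ℝ (Fin 3) × ℝ => U q.1 q.2) ∘ (ContinuousLinearEquiv.prodComm ℝ ℝ (EuclideanSpace ℝ (Fin 3))) := by
      funext q; rfl
    rw [e]
    exact hUj.comp (ContinuousLinearEquiv.prodComm ℝ ℝ (EuclideanSpace ℝ (Fin 3))).contDiff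
  exact h.contDiffOn

/-- **(8.2), first half, for a profile written `U(z, s)`** (the argument order of the summit-side
co-rotating profile lemmas, `∂ₛU(y,s) = fderiv ℝ (U y ·) s 1`): same statement as
`exists_norm_sliceDeriv_le_of_periodic`. [cite: PineauVicol2026, Lemma 8.1 (8.2) and its proof (p. 28)] -/
theorem exists_norm_timeDeriv_le_of_periodic (C : ℝ) :
    ∃ Cs : ℝ, ∀ (U : EuclideanSpace ℝ (Fin 3) → ℝ → EuclideanSpace ℝ (Fin 3)) (α S : ℝ), 0 < S →
      ContDiff ℝ ∞ (fun q : EuclideanSpace ℝ (Fin 3) × ℝ => U q.1 q.2) → (∀ y s, U y (s + S) = U y s) →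
      (∀ s, ∀ j ≤ 6, ∀ y, (1 + ‖y‖) ^ (j + 1) * ‖iteratedFDeriv ℝ j (fun z => U z s) y‖ ≤ C) →
      (∀ s y, fderiv ℝ (fun σ => U y σ) s 1 +
        α • (rotGen (U y s) - fderiv ℝ (fun z => U z s) y (rotGen y)) +
        (1 / 2 : ℝ) • U y s + (1 / 2 : ℝ) • fderiv ℝ (fun z => U z s) y y -
        (Δ (fun z => U z s)) y + convect (fun z => U z s) (fun z => U z s) y +
        gradient (pressurePotential (fun z => U z s)) y = 0) →
      ∀ s y, ‖fderiv ℝ (fun σ => U y σ) s 1‖ ≤ Cs * S * (1 + |α|) ^ 2 / (1 + ‖y‖) := by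
  obtain ⟨Cs, hCs⟩ := exists_norm_sliceDeriv_le_of_periodic C
  refine ⟨Cs, fun U α S hS hUj hper h83 heq s y => ?_⟩
  have hU' := isSmoothSpaceTimeOn_univ_swap hUj
  have h := hCs (fun s y => U y s) (fun σ y => deriv (fun τ => U y τ) σ) α S hS hU' rfl
    (fun σ y => hper y σ) h83 (fun σ y => by
      have e := heq σ y
      rw [fderiv_apply_one_eq_deriv] at e
      rw [← e]
      abel) s y
  rw [fderiv_apply_one_eq_deriv]
  exact h

/-- **(8.2), second half, for a profile written `U(z, s)`**: same statement as
`exists_norm_fderiv_sliceDeriv_le_of_periodic`.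
[cite: PineauVicol2026, Lemma 8.1 (8.2) and its proof (p. 28)] -/
theorem exists_norm_fderiv_timeDeriv_le_of_periodic (C : ℝ) :
    ∃ Cs : ℝ, ∀ (U : EuclideanSpace ℝ (Fin 3) → ℝ → EuclideanSpace ℝ (Fin 3)) (α S : ℝ), 0 < S →
      ContDiff ℝ ∞ (fun q : EuclideanSpace ℝ (Fin 3) × ℝ => U q.1 q.2) → (∀ y s, U y (s + S) = U y s) →
      (∀ s, ∀ j ≤ 7, ∀ y, (1 + ‖y‖) ^ (j + 1) * ‖iteratedFDeriv ℝ j (fun z => U z s) y‖ ≤ C) →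
      (∀ s y, fderiv ℝ (fun σ => U y σ) s 1 +
        α • (rotGen (U y s) - fderiv ℝ (fun z => U z s) y (rotGen y)) +
        (1 / 2 : ℝ) • U y s + (1 / 2 : ℝ) • fderiv ℝ (fun z => U z s) y y -
        (Δ (fun z => U z s)) y + convect (fun z => U z s) (fun z => U z s) y +
        gradient (pressurePotential (fun z => U z s)) y = 0) →
      ∀ s y, ‖fderiv ℝ (fun z => fderiv ℝ (fun σ => U z σ) s 1) y‖ ≤
        Cs * S * (1 + |α|) ^ 2 / (1 + ‖y‖) ^ 2 := by
  obtain ⟨Cs, hCs⟩ := exists_norm_fderiv_sliceDeriv_le_of_periodic C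
  refine ⟨Cs, fun U α S hS hUj hper h83 heq s y => ?_⟩
  have hU' := isSmoothSpaceTimeOn_univ_swap hUj
  have h := hCs (fun s y => U y s) (fun σ y => deriv (fun τ => U y τ) σ) α S hS hU' rfl
    (fun σ y => hper y σ) h83 (fun σ y => by
      have e := heq σ y
      rw [fderiv_apply_one_eq_deriv] at e
      rw [← e]
      abel) s y
  have e : (fun z => fderiv ℝ (fun σ => U z σ) s 1) = fun z => deriv (fun τ => U z τ) s :=
    funext fun z => fderiv_apply_one_eq_deriv
  rw [e]
  exact h

end Swap

end PineauVicol2026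

/-! ### (8.3) for the class with ONE constant up to a given order -/

section ClassUniform

/-- **(8.3) on the cell's class, uniformly up to order `N`**: one constant `K = K(N, C)` with
`(1+|y|)^{j+1} ‖Dʲ_y U(s,·)(y)‖ ≤ K` for all `j ≤ N`, all `s` and `y`, for every `V` of the class
`IsTypeIAncientMild C V ∧ HasTypeIDecay C V` (`U(s,·) = lerayOrbit V s`) — the finite maximum of the
constants of `IsTypeIAncientMild.exists_forall_pow_mul_norm_iteratedFDeriv_lerayOrbit_le_of_hasTypeIDecay`;
the shape of the (8.3) hypothesis of `exists_norm_sliceDeriv_le_of_periodic` (`N = 6`) and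
`exists_norm_fderiv_sliceDeriv_le_of_periodic` (`N = 7`).
[cite: PineauVicol2026, Lemma 8.1 (8.3) (p. 28); Lemma 7.1 (7.2) (p. 24)] -/
theorem IsTypeIAncientMild.exists_forall_le_pow_mul_norm_iteratedFDeriv_lerayOrbit_of_hasTypeIDecay
    (N : ℕ) (C : ℝ) :
    ∃ K : ℝ, 0 ≤ K ∧ ∀ ⦃V : ℝ → EuclideanSpace ℝ (Fin 3) → EuclideanSpace ℝ (Fin 3)⦄,
      IsTypeIAncientMild C V → HasTypeIDecay C V →
      ∀ (s : ℝ), ∀ j ≤ N, ∀ (y : EuclideanSpace ℝ (Fin 3)),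
        (1 + ‖y‖) ^ (j + 1) * ‖iteratedFDeriv ℝ j (lerayOrbit V s) y‖ ≤ K := by
  induction N with
  | zero =>
    obtain ⟨K, hK0, hK⟩ :=
      IsTypeIAncientMild.exists_forall_pow_mul_norm_iteratedFDeriv_lerayOrbit_le_of_hasTypeIDecay 0 C
    refine ⟨K, hK0, fun V hV hdec s j hj y => ?_⟩
    obtain rfl : j = 0 := Nat.le_zero.1 hj
    exact hK hV hdec s y
  | succ N ih =>
    obtain ⟨K₁, hK₁0, hK₁⟩ := ih
    obtain ⟨K₂, hK₂0, hK₂⟩ :=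
      IsTypeIAncientMild.exists_forall_pow_mul_norm_iteratedFDeriv_lerayOrbit_le_of_hasTypeIDecay
        (N + 1) C
    refine ⟨K₁ + K₂, by positivity, fun V hV hdec s j hj y => ?_⟩
    rcases Nat.lt_or_ge j (N + 1) with h | h
    · exact (hK₁ hV hdec s j (Nat.lt_succ_iff.1 h) y).trans (by linarith)
    · obtain rfl : j = N + 1 := le_antisymm hj h
      exact (hK₂ hV hdec s y).trans (by linarith)

end ClassUniform

end Literature.Analysis.FluidPDE
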